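import Summits.QuantumFields.YangMills.Theorems.ParabolicTrajectoryTunedSequenceExistsQFemtoReduction
import Summits.QuantumFields.YangMills.Theorems.ParabolicTrajectoryTunedSequenceExistsQNonFemto
import Summits.QuantumFields.YangMills.Theorems.ParabolicTrajectoryTunedSequenceExistsPNonFemto

/-!
# Crux `TunedSequenceExists` (stmt-QuantumFields-10524) vs the sibling crux `FemtoCurvatureTwoPointC`
# (stmt-QuantumFields-16204): headline corollaries of the Q-femto package (lead c5, line `fixed-aspect-window`)

The package (all landed `--supports stmt-QuantumFields-10524`): `…QFemtoBridge` (vocabulary; the Q-channel bridge; `Γ(0+) = 0`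
is forced), `…QFemtoReduction` ((U_Q,∃h) ⟸ the sibling; `FemtoCurvatureTwoPointC → VolumeMonotoneQRelAll → TunedSequenceExistsQ`),
`…QNonFemto` (femto tori of large aspect carry uniformly small rescaled `Q`-correlators; tuned `Q`-witnesses are eventually
non-femto), `…PNonFemto` (the same for the corner density `P` of the crux AS FILED: `D⁸|⟨P;τ_DP⟩| ≤ 36·C·Γ(D·a β)` on femto odd
tori; tuned witnesses are eventually non-femto).  This file only packages the two statements planners will quote:

* `exists_units_tuned_not_femto` — **granted the sibling crux, at every admissible `(G, r)` there are units `(a, ℓ₀)` (the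
  sibling's continuous unit map and femto radius) in which EVERY tuned sequence of the crux's type — any `M`, any `θ > 0`, any
  `M`-adic scheme with `β_k → ∞` and `(M^{n_k})⁸⟨P;τ_{M^{n_k}}P⟩_{β_k, side_k} → θ` — is eventually NON-femto:
  `ℓ₀ < side_k · a(β_k)` for all large `k`.**  So no proof of the crux can stay inside the femto universe of route
  `LangevinControlUV`: a thermodynamic-limit input (the line's child (V), or (V_Q,rel) for the `Q`-restatement) is NECESSARY.
* `tunedSequenceExists_witnesses_not_femto` — the same read against the crux itself: `TunedSequenceExists ∧ FemtoCurvatureTwoPointC`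
  ⇒ the witnesses (S) provides live on non-femto tori.
* `exists_units_tunedQ_not_femto` — the `Q`-version (time-zero plaquette), for the restatement option.
-/

noncomputable section

open Filter Topology MeasureTheory
open Literature.MathematicalPhysics.QuantumFieldTheory Literature.MathematicalPhysics.QuantumLattice

namespace Summit.QuantumFields.YangMills.Theorems.TunedSequenceExists.QFemto

open RPDiagonalVariant (spatialPlaquette)

/-- **Units in which every tuned `P`-sequence is eventually non-femto** (from the sibling crux; see the module docstring). -/
theorem exists_units_tuned_not_femto
    (hF : Summit.QuantumFields.YangMills.Theses.LangevinControlUV.FemtoCurvatureTwoPointC) :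
    ∀ (G : Type) [Group G] [TopologicalSpace G] [IsTopologicalGroup G] [CompactSpace G],
      IsCompactSimpleLieGroup G → letI : MeasurableSpace G := borel G
      haveI : BorelSpace G := ⟨rfl⟩
      ∀ (r : LatticeRep G),
    ∃ (a : ℝ → ℝ) (ℓ₀ : ℝ), Continuous a ∧ 0 < ℓ₀ ∧ (∀ β, 0 < a β) ∧ Tendsto a atTop (𝓝 0) ∧
      ∀ (M : ℕ) (θ : ℝ), 0 < θ → ∀ (sch : SpeciesScheme (YMSpecies G)) (n : ℕ → ℕ),
        (∀ k, sch.a k = ((M : ℝ) ^ n k)⁻¹) → Tendsto sch.β atTop atTop →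
        Tendsto (fun k => ((M : ℝ) ^ n k) ^ 8 *
          latticeConnectedCorr r.ρ (sch.β k) (sch.side k) r.curvature.F r.curvature.F (M ^ n k)) atTop (𝓝 θ) →
        ∀ᶠ k in atTop, ℓ₀ < (sch.side k : ℝ) * a (sch.β k) := by
  intro G _ _ _ _ hG
  letI : MeasurableSpace G := borel G
  haveI : BorelSpace G := ⟨rfl⟩
  intro r
  obtain ⟨a, ha, Γ, β₀, ℓ₀, c, C, h⟩ :=
    (cruxCAt_iff_exists_with r).1 ((FemtoCurvatureTwoPointC.femtoCurvatureTwoPointC_iff.1 hF) G hG r)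
  exact ⟨a, ℓ₀, ha, h.1, h.2.2.1, h.2.2.2.1, fun M θ hθ sch n hshape hβ hlim =>
    PNonFemto.eventually_not_femto_of_tuned r h ha hθ sch n hshape hβ hlim⟩

/-- **Units in which every tuned `Q`-sequence is eventually non-femto** (time-zero plaquette `Q = spatialPlaquette r`). -/
theorem exists_units_tunedQ_not_femto
    (hF : Summit.QuantumFields.YangMills.Theses.LangevinControlUV.FemtoCurvatureTwoPointC) :
    ∀ (G : Type) [Group G] [TopologicalSpace G] [IsTopologicalGroup G] [CompactSpace G],
      IsCompactSimpleLieGroup G → letI : MeasurableSpace G := borel G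
      haveI : BorelSpace G := ⟨rfl⟩
      ∀ (r : LatticeRep G),
    ∃ (a : ℝ → ℝ) (ℓ₀ : ℝ), Continuous a ∧ 0 < ℓ₀ ∧ (∀ β, 0 < a β) ∧ Tendsto a atTop (𝓝 0) ∧
      ∀ (M : ℕ) (θ : ℝ), 0 < θ → ∀ (sch : SpeciesScheme (YMSpecies G)) (n : ℕ → ℕ),
        (∀ k, sch.a k = ((M : ℝ) ^ n k)⁻¹) → Tendsto sch.β atTop atTop →
        Tendsto (fun k => ((M : ℝ) ^ n k) ^ 8 *
          latticeConnectedCorr r.ρ (sch.β k) (sch.side k) (spatialPlaquette r) (spatialPlaquette r) (M ^ n k))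
            atTop (𝓝 θ) →
        ∀ᶠ k in atTop, ℓ₀ < (sch.side k : ℝ) * a (sch.β k) := by
  intro G _ _ _ _ hG
  letI : MeasurableSpace G := borel G
  haveI : BorelSpace G := ⟨rfl⟩
  intro r
  obtain ⟨a, ha, Γ, β₀, ℓ₀, c, C, h⟩ :=
    (cruxCAt_iff_exists_with r).1 ((FemtoCurvatureTwoPointC.femtoCurvatureTwoPointC_iff.1 hF) G hG r)
  exact ⟨a, ℓ₀, ha, h.1, h.2.2.1, h.2.2.2.1, fun M θ hθ sch n hshape hβ hlim =>
    eventually_not_femto_of_tunedQ r h ha hθ sch n hshape hβ hlim⟩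

/-- **The crux's own witnesses are non-femto** (granted the sibling): `TunedSequenceExists` and `FemtoCurvatureTwoPointC` give,
for every admissible `(G, r, M ≥ 2)`, units `(a, ℓ₀)` and a window `(0, θ₀)` such that every `θ` in the window is realised
by a tuned `M`-adic Wilson scheme with `β_k → ∞` whose tori satisfy `ℓ₀ < side_k · a(β_k)` eventually. -/
theorem tunedSequenceExists_witnesses_not_femto
    (hS : Summit.QuantumFields.YangMills.Theses.ParabolicTrajectory.TunedSequenceExists)
    (hF : Summit.QuantumFields.YangMills.Theses.LangevinControlUV.FemtoCurvatureTwoPointC) :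
    ∀ (G : Type) [Group G] [TopologicalSpace G] [IsTopologicalGroup G] [CompactSpace G],
      IsCompactSimpleLieGroup G → letI : MeasurableSpace G := borel G
      haveI : BorelSpace G := ⟨rfl⟩
      ∀ (r : LatticeRep G) (M : ℕ), 2 ≤ M →
    ∃ (a : ℝ → ℝ) (ℓ₀ : ℝ), Continuous a ∧ 0 < ℓ₀ ∧ (∀ β, 0 < a β) ∧ Tendsto a atTop (𝓝 0) ∧
      ∃ θ₀ : ℝ, 0 < θ₀ ∧ ∀ θ : ℝ, 0 < θ → θ < θ₀ →
        ∃ (sch : SpeciesScheme (YMSpecies G)) (n : ℕ → ℕ),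
          (∀ k, sch.a k = ((M : ℝ) ^ n k)⁻¹) ∧ Tendsto sch.β atTop atTop ∧
          Tendsto (fun k => ((M : ℝ) ^ n k) ^ 8 *
            latticeConnectedCorr r.ρ (sch.β k) (sch.side k) r.curvature.F r.curvature.F (M ^ n k)) atTop (𝓝 θ) ∧
          ∀ᶠ k in atTop, ℓ₀ < (sch.side k : ℝ) * a (sch.β k) := by
  intro G _ _ _ _ hG
  letI : MeasurableSpace G := borel G
  haveI : BorelSpace G := ⟨rfl⟩
  intro r M hM
  obtain ⟨a, ℓ₀, ha, hℓ₀, hapos, hatend, hall⟩ := exists_units_tuned_not_femto hF G hG r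
  obtain ⟨θ₀, hθ₀, hwin⟩ := hS G hG r M hM
  refine ⟨a, ℓ₀, ha, hℓ₀, hapos, hatend, θ₀, hθ₀, fun θ hθ hθ' => ?_⟩
  obtain ⟨sch, n, hshape, hβ, -, hlim⟩ := hwin θ hθ hθ'
  exact ⟨sch, n, hshape, hβ, hlim, hall M θ hθ sch n hshape hβ hlim⟩

end Summit.QuantumFields.YangMills.Theorems.TunedSequenceExists.QFemto

end
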